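import Literature.Probability.Percolation.QuadCrossingNoise
import Mathlib.Topology.EMetricSpace.BoundedVariation
import Mathlib.Topology.EMetricSpace.VariationOnFromTo
import HarnessLib

/-!
# Covering a finite union of finite-length paths by `O(1/s)` balls of radius `s`

Topic `Literature/Probability/Percolation`; proofs file next to `QuadCrossingNoise.lean` (the cuts
`IsFiniteLengthPathUnion α` of Schramm–Smirnov's Theorem 1.7: finite unions of bounded-variation paths
with finitely many double points).  The regularity of the cut enters the proofs of O. Schramm,
S. Smirnov, *On the scaling limits of planar percolation*, Ann. Probab. 39 (2011), arXiv:1101.5820,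
exactly once, in the proof of the discrete gluing Theorem 1.1 (§2, p. 13): "By the regularity
assumption, we can choose `n ≤ C(α)/s` balls of radius `s`, entirely covering `α`.  Denote their
centers by `w₁, w₂, …, w_n`" (the count `n ≲ 1/s` is what makes the sum of the `n` four-arm bounds
`(2s/(d/2)) · Δ₄` small; Thm. 1.1 is stated for `α` "a finite union of finite length paths, or more
generally a set of finite one-dimensional upper Minkowski content").  This file proves that
covering statement:

* `exists_finset_forall_dist_lt_of_boundedVariationOn` — a function `f : [0,1] → E` of bounded
  variation `L` into a pseudo-metric space admits, for every `s > 0`, at most `L/s + 1` parameters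
  `t'` such that every value `f t` is within `s` of some `f t'` (bin the monotone variation function
  `t ↦ V(f; [0, t])` into intervals of length `s`; values in one bin are `s`-close because
  `dist (f t) (f t') ≤ |V(0,t) - V(0,t')|`);
* `IsFiniteLengthPathUnion.exists_finset_cover` — **a cut `α` is covered, for every `0 < s ≤ 1`,
  by at most `C(α)/s` open balls of radius `s` centred ON `α`**, with
  `C(α) = Σᵢ (length(γᵢ) + 1)`.

No percolation; no named fact.

## References

* O. Schramm, S. Smirnov, Ann. Probab. 39 (2011) 1768–1814, arXiv:1101.5820, Thm. 1.1 and §2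
  (proof of Thm. 1.1). [SchrammSmirnov2011]

Mathlib: `eVariationOn`, `BoundedVariationOn.dist_le`, `variationOnFromTo` (`.add`, `.eq_of_le`,
`.abs_le_eVariationOn`), `Nat.floor`.
-/

noncomputable section

open Set Metric
open scoped unitInterval ENNReal

namespace Literature.Probability.Percolation

namespace QuadCrossing

/-! ### One path of bounded variation -/

/-- **Finitely many values `s`-approximate a curve of finite length.**  If `f : [0,1] → E` has
bounded variation `L = V(f; [0,1])` (a pseudo-metric target), then for every `s > 0` there is a
finite set `T` of at most `L/s + 1` parameters such that every `f t` is within distance `< s` of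
`f t'` for some `t' ∈ T`.  (Bin `t` according to `⌊V(f; [0,t]) / s⌋ ∈ {0, …, ⌊L/s⌋}` and keep one
parameter per nonempty bin: inside a bin, `dist (f t) (f t') ≤ |V(0,t) - V(0,t')| < s`.)
[cite: SchrammSmirnov2011, §2 (proof of Thm. 1.1: "n ≤ C(α)/s balls of radius s, entirely covering α")] -/
theorem exists_finset_forall_dist_lt_of_boundedVariationOn {E : Type*} [PseudoMetricSpace E]
    {f : I → E} (hf : BoundedVariationOn f univ) {s : ℝ} (hs : 0 < s) :
    ∃ T : Finset I, (T.card : ℝ) ≤ (eVariationOn f univ).toReal / s + 1 ∧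
      ∀ t : I, ∃ t' ∈ T, dist (f t) (f t') < s := by
  classical
  set L : ℝ := (eVariationOn f univ).toReal with hL
  have hL0 : 0 ≤ L := ENNReal.toReal_nonneg
  have hlbv : LocallyBoundedVariationOn f univ := hf.locallyBoundedVariationOn
  -- the variation function `v t = V(f; [0, t])`
  set v : I → ℝ := fun t => variationOnFromTo f univ 0 t with hv
  have h0le : ∀ t : I, (0 : I) ≤ t := fun t => Subtype.coe_le_coe.1 (unitInterval.nonneg t)
  have hv0 : ∀ t, 0 ≤ v t := fun t => variationOnFromTo.nonneg_of_le f univ (h0le t)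
  have hvL : ∀ t, v t ≤ L := fun t =>
    (le_abs_self _).trans (variationOnFromTo.abs_le_eVariationOn hf)
  have hdist : ∀ t t' : I, dist (f t) (f t') ≤ |v t - v t'| := by
    intro t t'
    wlog htt : t ≤ t' generalizing t t'
    · rw [dist_comm, abs_sub_comm]; exact this t' t (le_of_not_ge htt)
    have h1 : dist (f t) (f t') ≤ (eVariationOn f (univ ∩ Icc t t')).toReal :=
      (hf.mono inter_subset_left).dist_le ⟨mem_univ _, le_rfl, htt⟩ ⟨mem_univ _, htt, le_rfl⟩
    have h2 : v t + variationOnFromTo f univ t t' = v t' :=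
      variationOnFromTo.add hlbv (mem_univ (0 : I)) (mem_univ t) (mem_univ t')
    rw [variationOnFromTo.eq_of_le f univ htt] at h2
    have hnn : 0 ≤ (eVariationOn f (univ ∩ Icc t t')).toReal := ENNReal.toReal_nonneg
    have h3 : |v t - v t'| = (eVariationOn f (univ ∩ Icc t t')).toReal := by
      rw [abs_sub_comm, abs_of_nonneg (by linarith)]
      linarith
    rw [h3]; exact h1
  -- the bins `k t = ⌊v t / s⌋ ≤ N = ⌊L / s⌋`
  set N : ℕ := ⌊L / s⌋₊ with hN
  set k : I → ℕ := fun t => ⌊v t / s⌋₊ with hk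
  have hkN : ∀ t, k t ≤ N := fun t => Nat.floor_mono (div_le_div_of_nonneg_right (hvL t) hs.le)
  have hbin : ∀ t, (k t : ℝ) * s ≤ v t ∧ v t < (k t + 1) * s := by
    intro t
    have h := (Nat.floor_eq_iff (div_nonneg (hv0 t) hs.le)).1 (rfl : ⌊v t / s⌋₊ = k t)
    exact ⟨(le_div_iff₀ hs).1 h.1, (div_lt_iff₀ hs).1 h.2⟩
  -- one representative per nonempty bin
  set rep : ℕ → I := fun k₀ => if h : ∃ t, k t = k₀ then h.choose else 0 with hrep
  have hrep_spec : ∀ t, k (rep (k t)) = k t := by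
    intro t
    have h : ∃ t', k t' = k t := ⟨t, rfl⟩
    have : rep (k t) = h.choose := by rw [hrep]; exact dif_pos h
    rw [this]
    exact h.choose_spec
  refine ⟨(Finset.range (N + 1)).image rep, ?_, fun t => ?_⟩
  · calc (((Finset.range (N + 1)).image rep).card : ℝ) ≤ ((Finset.range (N + 1)).card : ℝ) := by
          exact_mod_cast Finset.card_image_le
      _ = N + 1 := by rw [Finset.card_range]; push_cast; ring
      _ ≤ L / s + 1 := by
          have : (N : ℝ) ≤ L / s := Nat.floor_le (div_nonneg hL0 hs.le)
          linarith
  · refine ⟨rep (k t), Finset.mem_image.2 ⟨k t, Finset.mem_range.2 (Nat.lt_succ_of_le (hkN t)),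
      rfl⟩, (hdist t (rep (k t))).trans_lt ?_⟩
    have h1 := hbin t
    have h2 := hbin (rep (k t))
    rw [hrep_spec t] at h2
    rw [abs_lt]
    constructor <;> linarith [h1.1, h1.2, h2.1, h2.2]

/-! ### Cuts: finite unions of finite-length paths -/

/-- **"We can choose `n ≤ C(α)/s` balls of radius `s`, entirely covering `α`"** (Schramm–Smirnov,
proof of Thm. 1.1): a finite union `α` of bounded-variation paths admits a constant `C(α) ≥ 0`
(namely `Σᵢ (V(γᵢ) + 1)`) such that for every `0 < s ≤ 1` some finite set `W ⊆ α` of at most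
`C(α)/s` centres has `α ⊆ ⋃_{w ∈ W} B(w, s)`. [cite: SchrammSmirnov2011, §2 (proof of Thm. 1.1)] -/
theorem IsFiniteLengthPathUnion.exists_finset_cover {α : Set ℂ} (hα : IsFiniteLengthPathUnion α) :
    ∃ C : ℝ, 0 ≤ C ∧ ∀ s : ℝ, 0 < s → s ≤ 1 →
      ∃ W : Finset ℂ, (↑W : Set ℂ) ⊆ α ∧ (W.card : ℝ) ≤ C / s ∧ α ⊆ ⋃ w ∈ W, ball w s := by
  classical
  obtain ⟨n, γ, rfl, hbv, -⟩ := hα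
  set Lv : Fin n → ℝ := fun i => (eVariationOn (γ i) univ).toReal with hLv
  have hLv0 : ∀ i, 0 ≤ Lv i := fun i => ENNReal.toReal_nonneg
  refine ⟨∑ i, (Lv i + 1), Finset.sum_nonneg fun i _ => by linarith [hLv0 i], fun s hs hs1 => ?_⟩
  choose T hTcard hT using fun i =>
    exists_finset_forall_dist_lt_of_boundedVariationOn (hbv i) hs
  refine ⟨Finset.univ.biUnion fun i => (T i).image (γ i), ?_, ?_, ?_⟩
  · intro w hw
    simp only [Finset.coe_biUnion, Finset.coe_univ, mem_univ, iUnion_true, mem_iUnion,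
      Finset.coe_image, mem_image, Finset.mem_coe] at hw
    obtain ⟨i, t, -, rfl⟩ := hw
    exact mem_iUnion.2 ⟨i, mem_range_self t⟩
  · calc ((Finset.univ.biUnion fun i => (T i).image (γ i)).card : ℝ)
        ≤ ∑ i, (((T i).image (γ i)).card : ℝ) := by
          exact_mod_cast Finset.card_biUnion_le
      _ ≤ ∑ i, ((T i).card : ℝ) := Finset.sum_le_sum fun i _ => by
          exact_mod_cast Finset.card_image_le
      _ ≤ ∑ i, (Lv i / s + 1) := Finset.sum_le_sum fun i _ => hTcard i
      _ ≤ ∑ i, (Lv i + 1) / s := Finset.sum_le_sum fun i _ => by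
          rw [add_div]
          have : (1 : ℝ) ≤ 1 / s := by rw [le_div_iff₀ hs]; linarith
          linarith
      _ = (∑ i, (Lv i + 1)) / s := by rw [Finset.sum_div]
  · intro x hx
    obtain ⟨i, hi⟩ := mem_iUnion.1 hx
    obtain ⟨t, rfl⟩ := hi
    obtain ⟨t', ht', hd⟩ := hT i t
    refine mem_iUnion₂.2 ⟨γ i t', ?_, ?_⟩
    · exact Finset.mem_biUnion.2 ⟨i, Finset.mem_univ i, Finset.mem_image.2 ⟨t', ht', rfl⟩⟩
    · rwa [mem_ball]

end QuadCrossing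

end Literature.Probability.Percolation

end
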